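import Summits.PneNP.PneNP.Theorems.ConvexRankGatesConvexGateBlindExactLiftingTrianglePairSplit
import Summits.PneNP.PneNP.Theorems.ConvexRankGatesConvexGateBlindExactLiftingTriangleLineSpread

/-!
# Triangle instance — ℓ²-spread of the line-mass marginals of a line-free atom (lead c6, THEOREM C√ step F4)

Support file for crux `ConvexGateBlind` (stmt-PneNP-10680), line `xor-door-perfect-completeness`, open stub
`stub_exactLifting`; part of the Lean route to THEOREM C√ (memo `THEOREM-C-sqrt.md` on the item).

For a LINE-FREE non-negative interaction-free atom `v` (every line contains a zero; the normal form of
`…TrianglePeeling`): every plane carries at most the mass, so the zero identity of `…TriangleLineSpread`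
(`t²ℓ(w₀) + m = t·p(w₀)` at a zero `w₀`) bounds every line: `t²·line ≤ 3t·mass` in all three directions
(`line1/2/3_le_of_lineFree`); since the lines of one direction carry total mass `mass`, the line-mass marginals are
ℓ²-spread: `t · Σ_{a,b} marg(a,b)² ≤ 3 · mass²` for each of the three marginals (`sum_marg_sq_le`, registered form
`triangle_marginal_spread`).  This is the input `‖μ_ij‖_F² ≤ 3m²/t` of the chaos tail bound (`…TriangleChaosTail`).

Nothing here is cited; everything is elementary.
-/

set_option linter.dupNamespace false -- `Summit.PneNP.PneNP.…`: summit = sub-problem (D-0017)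

namespace Summit.PneNP.PneNP.Theorems.XorDoor.TriLine.Heavy

open Finset Classical

noncomputable section

variable {t : ℕ}

/-- the mass as an iterated sum -/
lemma mass_eq_sum3 (v : Tri t → ℝ) : mass v = ∑ a, ∑ b, ∑ d, v (a, b, d) := by
  simp only [mass, Fintype.sum_prod_type]

/-- every plane of a non-negative `v` carries at most the mass: direction 1 -/
lemma plane1_le_mass {v : Tri t → ℝ} (hnn : ∀ w, 0 ≤ v w) (a : Fin t) : ∑ b', ∑ d', v (a, b', d') ≤ mass v := by
  rw [mass_eq_sum3]
  exact single_le_sum (f := fun a' => ∑ b', ∑ d', v (a', b', d'))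
    (fun a' _ => sum_nonneg fun _ _ => sum_nonneg fun _ _ => hnn _) (mem_univ a)

/-- direction 2 -/
lemma plane2_le_mass {v : Tri t → ℝ} (hnn : ∀ w, 0 ≤ v w) (b : Fin t) : ∑ a', ∑ d', v (a', b, d') ≤ mass v := by
  rw [mass_eq_sum3]
  refine sum_le_sum fun a' _ => ?_
  exact single_le_sum (f := fun b' => ∑ d', v (a', b', d')) (fun b' _ => sum_nonneg fun _ _ => hnn _) (mem_univ b)

/-- direction 3 -/
lemma plane3_le_mass {v : Tri t → ℝ} (hnn : ∀ w, 0 ≤ v w) (d : Fin t) : ∑ a', ∑ b', v (a', b', d) ≤ mass v := by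
  rw [mass_eq_sum3]
  refine sum_le_sum fun a' _ => sum_le_sum fun b' _ => ?_
  exact single_le_sum (f := fun d' => v (a', b', d')) (fun d' _ => hnn _) (mem_univ d)

/-- `totalMass = mass` -/
lemma totalMass_eq_mass (v : Tri t → ℝ) : totalMass v = mass v := by
  simp only [totalMass, mass, Fintype.sum_prod_type]

/-- for a line-free non-negative interaction-free `v`, the three lines through a zero all obey `t²·line ≤ 3t·mass − mass`;
stated per direction: direction-1 lines `{(·,b,d)}` -/
lemma line1_le_of_lineFree {v : Tri t → ℝ} (hnn : ∀ w, 0 ≤ v w) (hIF : InteractionFree v) (hlf : LineFree v)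
    (b d : Fin t) : (t : ℝ) ^ 2 * marg23 v b d ≤ 3 * t * mass v := by
  obtain ⟨f, g, h, hfgh⟩ := hIF
  have hP : PlaneBound v (mass v) := ⟨plane1_le_mass hnn, plane2_le_mass hnn, plane3_le_mass hnn⟩
  have := lineFree_lineMass_le hnn f g h hfgh hlf hP b d
  rw [totalMass_eq_mass] at this
  unfold marg23
  have hm : 0 ≤ mass v := sum_nonneg fun w _ => hnn w
  linarith

/-- direction-2 lines `{(a,·,d)}` -/
lemma line2_le_of_lineFree {v : Tri t → ℝ} (hnn : ∀ w, 0 ≤ v w) (hIF : InteractionFree v) (hlf : LineFree v)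
    (a d : Fin t) : (t : ℝ) ^ 2 * marg13 v a d ≤ 3 * t * mass v := by
  obtain ⟨f, g, h, hfgh⟩ := hIF
  obtain ⟨b, hb⟩ := hlf.2.1 a d
  have hid := lineMass3_eq_of_zero f g h hfgh hb
  rw [totalMass_eq_mass] at hid
  have hp : planeMass3 v a b d ≤ 3 * mass v := by
    unfold planeMass3
    linarith [plane1_le_mass hnn a, plane2_le_mass hnn b, plane3_le_mass hnn d]
  have h1 : 0 ≤ ∑ a', v (a', b, d) := sum_nonneg fun _ _ => hnn _
  have h3 : 0 ≤ ∑ d', v (a, b, d') := sum_nonneg fun _ _ => hnn _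
  have hm : 0 ≤ mass v := sum_nonneg fun w _ => hnn w
  have hT : (0 : ℝ) ≤ t := Nat.cast_nonneg t
  unfold marg13
  unfold lineMass3 at hid
  nlinarith

/-- direction-3 lines `{(a,b,·)}` -/
lemma line3_le_of_lineFree {v : Tri t → ℝ} (hnn : ∀ w, 0 ≤ v w) (hIF : InteractionFree v) (hlf : LineFree v)
    (a b : Fin t) : (t : ℝ) ^ 2 * marg12 v a b ≤ 3 * t * mass v := by
  obtain ⟨f, g, h, hfgh⟩ := hIF
  obtain ⟨d, hd⟩ := hlf.2.2 a b
  have hid := lineMass3_eq_of_zero f g h hfgh hd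
  rw [totalMass_eq_mass] at hid
  have hp : planeMass3 v a b d ≤ 3 * mass v := by
    unfold planeMass3
    linarith [plane1_le_mass hnn a, plane2_le_mass hnn b, plane3_le_mass hnn d]
  have h1 : 0 ≤ ∑ a', v (a', b, d) := sum_nonneg fun _ _ => hnn _
  have h2 : 0 ≤ ∑ b', v (a, b', d) := sum_nonneg fun _ _ => hnn _
  have hm : 0 ≤ mass v := sum_nonneg fun w _ => hnn w
  have hT : (0 : ℝ) ≤ t := Nat.cast_nonneg t
  unfold marg12
  unfold lineMass3 at hid
  nlinarith

/-- the three marginals have the mass as total -/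
lemma sum_marg12 (v : Tri t → ℝ) : ∑ a, ∑ b, marg12 v a b = mass v := by
  rw [mass_eq_sum3]; rfl

/-- `(1,3)` marginal -/
lemma sum_marg13 (v : Tri t → ℝ) : ∑ a, ∑ d, marg13 v a d = mass v := by
  rw [mass_eq_sum3]
  unfold marg13
  exact sum_congr rfl fun a _ => sum_comm

/-- `(2,3)` marginal -/
lemma sum_marg23 (v : Tri t → ℝ) : ∑ b, ∑ d, marg23 v b d = mass v := by
  rw [mass_eq_sum3]
  unfold marg23
  have h1 : ∀ b : Fin t, ∑ d, ∑ a, v (a, b, d) = ∑ a, ∑ d, v (a, b, d) := fun b => sum_comm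
  simp_rw [h1]
  exact sum_comm

/-- **ℓ²-spread of the marginals of a line-free atom**: `t·Σ marg² ≤ 3·mass²` (each line `≤ 3 mass/t`, total `mass`). -/
theorem sum_marg_sq_le {v : Tri t → ℝ} (hnn : ∀ w, 0 ≤ v w) (hIF : InteractionFree v) (hlf : LineFree v) :
    (t : ℝ) * ∑ a, ∑ b, marg12 v a b ^ 2 ≤ 3 * mass v ^ 2 ∧
    (t : ℝ) * ∑ a, ∑ d, marg13 v a d ^ 2 ≤ 3 * mass v ^ 2 ∧
    (t : ℝ) * ∑ b, ∑ d, marg23 v b d ^ 2 ≤ 3 * mass v ^ 2 := by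
  have hT : (0 : ℝ) ≤ t := Nat.cast_nonneg t
  have hm : 0 ≤ mass v := sum_nonneg fun w _ => hnn w
  -- generic step: if `t·x ≤ 3m` termwise (times `t`) and `Σ x = m` with `x ≥ 0`, then `t·Σx² ≤ 3m·m`
  have key : ∀ (x : Fin t → Fin t → ℝ), (∀ i j, 0 ≤ x i j) → (∀ i j, (t : ℝ) ^ 2 * x i j ≤ 3 * t * mass v) →
      ∑ i, ∑ j, x i j = mass v → (t : ℝ) * ∑ i, ∑ j, x i j ^ 2 ≤ 3 * mass v ^ 2 := by
    intro x hx hle hsum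
    rcases Nat.eq_zero_or_pos t with ht0 | htpos
    · subst ht0; simp; positivity
    have hTpos : (0 : ℝ) < t := by exact_mod_cast htpos
    have hle' : ∀ i j, (t : ℝ) * x i j ≤ 3 * mass v := by
      intro i j
      have := hle i j
      have : (t : ℝ) * ((t : ℝ) * x i j) ≤ (t : ℝ) * (3 * mass v) := by nlinarith
      exact le_of_mul_le_mul_left this hTpos
    calc (t : ℝ) * ∑ i, ∑ j, x i j ^ 2 = ∑ i, ∑ j, (t * x i j) * x i j := by
          rw [mul_sum]; refine sum_congr rfl fun i _ => ?_
          rw [mul_sum]; refine sum_congr rfl fun j _ => by ring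
      _ ≤ ∑ i, ∑ j, (3 * mass v) * x i j :=
          sum_le_sum fun i _ => sum_le_sum fun j _ => mul_le_mul_of_nonneg_right (hle' i j) (hx i j)
      _ = 3 * mass v * ∑ i, ∑ j, x i j := by
          rw [mul_sum]; exact sum_congr rfl fun i _ => by rw [mul_sum]
      _ = 3 * mass v ^ 2 := by rw [hsum]; ring
  refine ⟨key (marg12 v) (fun a b => sum_nonneg fun _ _ => hnn _) (line3_le_of_lineFree hnn hIF hlf) (sum_marg12 v),
    key (marg13 v) (fun a d => sum_nonneg fun _ _ => hnn _) (line2_le_of_lineFree hnn hIF hlf) (sum_marg13 v),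
    key (marg23 v) (fun b d => sum_nonneg fun _ _ => hnn _) (line1_le_of_lineFree hnn hIF hlf) (sum_marg23 v)⟩


/-- **Marginal spread, registered form** (sub-goal `triangle_marginal_spread` of stmt-PneNP-10680). -/
theorem triangle_marginal_spread : ∀ {t : ℕ} {v : Tri t → ℝ}, (∀ w, 0 ≤ v w) → InteractionFree v → LineFree v → (t : ℝ) * ∑ a, ∑ b, marg12 v a b ^ 2 ≤ 3 * mass v ^ 2 ∧ (t : ℝ) * ∑ a, ∑ d, marg13 v a d ^ 2 ≤ 3 * mass v ^ 2 ∧ (t : ℝ) * ∑ b, ∑ d, marg23 v b d ^ 2 ≤ 3 * mass v ^ 2 :=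
  fun hnn hIF hlf => sum_marg_sq_le hnn hIF hlf

end

end Summit.PneNP.PneNP.Theorems.XorDoor.TriLine.Heavy
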